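import Summits.QuantumAdvantage.QuantumAdvantage.Theorems.SymplecticPurityDlogGraphFlatFlankA

/-!
# Crux `DlogGraphFlat` (stmt-QuantumAdvantage-10732), line `Sketch` — sector B: Hölder over a digit block

Burgess-type amplification for the twisted Walsh sums `W(α,β) = Σ_x (−1)^{α·x}(−1)^{β·bits(gˣ mod p)}`
(idea card `Cruxes/DlogGraphFlat/Ideas/burgess-digit-block-amplification.md`): split the exponent at
digit `m`, `x = x_lo + x_hi`; the `𝔽₂`-linear phase factorises, `gˣ = g^{x_hi}·g^{x_lo}` with outer
multipliers `λ = g^{ofBits x_hi}` of multiplicity ≤ 2 (`stub_dlogOrbitFibre`), and two Cauchy–Schwarz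
steps over the high patterns followed by positivity give the registered stub `stub_dlogWalshHolder`:
the fourth dilation moment bound `Σ_λ (Σ_{x_lo<2^m} ε F_β(λ g^{x_lo}))⁴ ≤ C(4^m p + 16^m p^{1−η})`
(`stub_dlogFourthDilationMoment`, every sign pattern `ε`) implies `|W(α,β)| ≤ 2^{(1−δ)n}` with
`δ = min(μ, min(η,1)/2)/8` — BOTH masks' dependence on `x` is gone. No new definitions.
-/

set_option linter.dupNamespace false -- D-0017: single-problem summit ⇒ `QuantumAdvantage.QuantumAdvantage` by design

namespace Summit.QuantumAdvantage.QuantumAdvantage.Theorems.SymplecticPurity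

open Finset Literature.Computability.QuantumComplexity Literature.Computability.Cryptography

/-! ### Hölder over a digit block of the exponent (Burgess amplification): sector B becomes b-free -/

section Holder

open Literature.Computability.QuantumComplexity Literature.Computability.Cryptography

variable {n : ℕ}

/-- Sign factorisation of an `𝔽₂`-linear phase over a mask split:
`(−1)^{α·x} = (−1)^{α·(x∧d)} (−1)^{α·(x∧¬d)}`. -/
theorem sign_split (α x d : QReg n) :
    (∏ i : Fin n, (if α i && x i then (-1 : ℝ) else 1)) =
      (∏ i : Fin n, (if α i && (x i && d i) then (-1 : ℝ) else 1)) *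
        ∏ i : Fin n, (if α i && (x i && !d i) then (-1 : ℝ) else 1) := by
  rw [← Finset.prod_mul_distrib]
  refine Finset.prod_congr rfl fun i _ => ?_
  cases α i <;> cases x i <;> cases d i <;> simp

/-- A product of signs has absolute value `1`. -/
theorem abs_sign_prod (α z : QReg n) :
    |∏ i : Fin n, (if α i && z i then (-1 : ℝ) else 1)| = 1 := by
  rw [Finset.abs_prod]
  refine Finset.prod_eq_one fun i _ => ?_
  split_ifs <;> simp

/-- Two Cauchy–Schwarz steps: `(Σ_{v∈s} |f v|)⁴ ≤ |s|³ Σ_{v∈s} (f v)⁴`. -/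
theorem sum_abs_pow_four_le {ι : Type*} (s : Finset ι) (f : ι → ℝ) :
    (∑ v ∈ s, |f v|) ^ 4 ≤ (s.card : ℝ) ^ 3 * ∑ v ∈ s, (f v) ^ 4 := by
  have h1 : (∑ v ∈ s, |f v| * 1) ^ 2 ≤ (∑ v ∈ s, |f v| ^ 2) * ∑ v ∈ s, (1 : ℝ) ^ 2 :=
    Finset.sum_mul_sq_le_sq_mul_sq s (fun v => |f v|) (fun _ => 1)
  have h2 : (∑ v ∈ s, (f v) ^ 2 * 1) ^ 2 ≤ (∑ v ∈ s, ((f v) ^ 2) ^ 2) * ∑ v ∈ s, (1 : ℝ) ^ 2 :=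
    Finset.sum_mul_sq_le_sq_mul_sq s (fun v => (f v) ^ 2) (fun _ => 1)
  simp only [mul_one, one_pow, Finset.sum_const, nsmul_eq_mul, sq_abs] at h1 h2
  have e4 : ∀ v, ((f v) ^ 2) ^ 2 = (f v) ^ 4 := fun v => by ring
  simp only [e4] at h2
  calc (∑ v ∈ s, |f v|) ^ 4 = ((∑ v ∈ s, |f v|) ^ 2) ^ 2 := by ring
    _ ≤ ((∑ v ∈ s, (f v) ^ 2) * s.card) ^ 2 := pow_le_pow_left₀ (sq_nonneg _) h1 2
    _ = (∑ v ∈ s, (f v) ^ 2) ^ 2 * (s.card : ℝ) ^ 2 := by ring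
    _ ≤ ((∑ v ∈ s, (f v) ^ 4) * s.card) * (s.card : ℝ) ^ 2 :=
        mul_le_mul_of_nonneg_right h2 (sq_nonneg _)
    _ = (s.card : ℝ) ^ 3 * ∑ v ∈ s, (f v) ^ 4 := by ring

/-- Multiplicity step: along `v ↦ g^{ofBits v}` (at most two-to-one) a non-negative function sums to
at most twice its complete sum over `ZMod p`. -/
theorem sum_pow_orbit_le {p g : ℕ} [hpf : Fact p.Prime] (hg : orderOf (g : ZMod p) = p - 1)
    (h2 : 2 ^ n ≤ 2 * (p - 1)) (S : Finset (QReg n)) (φ : ZMod p → ℝ) (hφ : ∀ t, 0 ≤ φ t) :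
    ∑ v ∈ S, φ ((g : ZMod p) ^ Nat.ofBits v) ≤ 2 * ∑ t : ZMod p, φ t := by
  classical
  have hp : p.Prime := hpf.out
  rw [Finset.sum_comp (s := S) (f := φ) (g := fun v : QReg n => (g : ZMod p) ^ Nat.ofBits v)]
  calc ∑ t ∈ S.image (fun v : QReg n => (g : ZMod p) ^ Nat.ofBits v),
        (S.filter fun v => (g : ZMod p) ^ Nat.ofBits v = t).card • φ t
      ≤ ∑ t ∈ S.image (fun v : QReg n => (g : ZMod p) ^ Nat.ofBits v), (2 : ℝ) * φ t := by
        refine Finset.sum_le_sum fun t _ => ?_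
        rw [nsmul_eq_mul]
        refine mul_le_mul_of_nonneg_right ?_ (hφ t)
        have hle : (S.filter fun v => (g : ZMod p) ^ Nat.ofBits v = t).card ≤ 2 :=
          le_trans (Finset.card_le_card (Finset.filter_subset_filter _ (Finset.subset_univ S)))
            (stub_dlogOrbitFibre n p g hp hg h2 t)
        exact_mod_cast hle
    _ ≤ ∑ t : ZMod p, (2 : ℝ) * φ t :=
        Finset.sum_le_sum_of_subset_of_nonneg (Finset.subset_univ _)
          (fun t _ _ => mul_nonneg (by norm_num) (hφ t))
    _ = 2 * ∑ t : ZMod p, φ t := by rw [Finset.mul_sum]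

/-- The block fibre as a bijection: for a pattern `v` of the high bits, summing `Φ (x ∧ d)` over the
labels `x` with `x ∧ ¬d = v` is summing `Φ` over the patterns supported on the block `d`. -/
theorem sum_fibre_block (d v : QReg n) (hv : ∀ j, d j = true → v j = false) (Φ : QReg n → ℝ) :
    ∑ x ∈ (Finset.univ.filter fun x : QReg n => (fun j => x j && !d j) = v), Φ (fun j => x j && d j) =
      ∑ u ∈ (Finset.univ.filter fun u : QReg n => ∀ j, d j = false → u j = false), Φ u := by
  classical
  refine Finset.sum_nbij' (fun x => fun j => x j && d j) (fun u => fun j => u j || v j) ?_ ?_ ?_ ?_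
    (fun _ _ => rfl)
  · intro x hx
    rw [Finset.mem_filter] at hx ⊢
    refine ⟨Finset.mem_univ _, fun j hj => by simp [hj]⟩
  · intro u hu
    rw [Finset.mem_filter] at hu ⊢
    refine ⟨Finset.mem_univ _, ?_⟩
    funext j
    have h1 := hu.2 j
    have h2 := hv j
    revert h1 h2
    dsimp only
    cases u j <;> cases v j <;> cases d j <;> simp
  · intro x hx
    rw [Finset.mem_filter] at hx
    funext j
    have e := congrFun hx.2 j
    revert e
    simp only
    cases x j <;> cases d j <;> cases v j <;> simp
  · intro u hu
    rw [Finset.mem_filter] at hu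
    funext j
    have h1 := hu.2 j
    have h2 := hv j
    revert h1 h2
    simp only
    cases u j <;> cases v j <;> cases d j <;> simp

/-- **The Hölder / Burgess amplification step for the DLOG Walsh sums.** For every block length
`m ≤ n`, every pair of masks and every `±1` weight on the high patterns absorbed by the triangle
inequality: with `d = {j < m}`, `PV = {x ∧ ¬d}`, `PJ = {u : u_j = 0 for j ≥ m}`,
`|W(α,β)|⁴ ≤ |PV|³ · 2 · Σ_{λ ∈ ZMod p} (Σ_{u ∈ PJ} (−1)^{α·u} F_β(λ g^{ofBits u}))⁴`. -/
theorem walsh_pow_four_le_moment {p g : ℕ} [hpf : Fact p.Prime]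
    (hg : orderOf (g : ZMod p) = p - 1) (h2 : 2 ^ n ≤ 2 * (p - 1)) (α β : QReg n) (m : ℕ) :
    |∑ x : QReg n, (∏ i : Fin n, (if α i && x i then (-1 : ℝ) else 1)) *
        (∏ i : Fin n, (if β i && (g ^ Nat.ofBits x % p).testBit (i : ℕ) then (-1 : ℝ) else 1))| ^ 4 ≤
      ((Finset.univ.image fun x : QReg n => fun j => x j && !decide ((j : ℕ) < m)).card : ℝ) ^ 3 *
        (2 * ∑ lam : ZMod p,
          (∑ u ∈ (Finset.univ.filter fun u : QReg n => ∀ j : Fin n, m ≤ (j : ℕ) → u j = false),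
            (∏ i : Fin n, (if α i && u i then (-1 : ℝ) else 1)) *
              ∏ i : Fin n, (if β i && (lam * (g : ZMod p) ^ Nat.ofBits u).val.testBit (i : ℕ)
                then (-1 : ℝ) else 1)) ^ 4) := by
  classical
  have hp : p.Prime := hpf.out
  set d : QReg n := fun j => decide ((j : ℕ) < m) with hd
  set G : ZMod p := (g : ZMod p) with hG
  set A : QReg n → ℝ := fun z => ∏ i : Fin n, (if α i && z i then (-1 : ℝ) else 1) with hA
  set F : ZMod p → ℝ := fun y => ∏ i : Fin n, (if β i && y.val.testBit (i : ℕ) then (-1 : ℝ) else 1)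
    with hF
  set PV := Finset.univ.image fun x : QReg n => fun j => x j && !d j with hPV
  set PJ := Finset.univ.filter fun u : QReg n => ∀ j : Fin n, m ≤ (j : ℕ) → u j = false with hPJ
  set I : ZMod p → ℝ := fun lam => ∑ u ∈ PJ, A u * F (lam * G ^ Nat.ofBits u) with hI
  have hPJ' : PJ = Finset.univ.filter fun u : QReg n => ∀ j, d j = false → u j = false := by
    rw [hPJ]
    congr 1
    ext u
    simp only [hd, decide_eq_false_iff_not, not_lt]
  have hval : ∀ x : QReg n, (g ^ Nat.ofBits x % p) = (G ^ Nat.ofBits x).val := by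
    intro x
    rw [hG, ← Nat.cast_pow, ZMod.val_natCast]
  have hsummand : ∀ x : QReg n,
      (∏ i : Fin n, (if α i && x i then (-1 : ℝ) else 1)) *
        (∏ i : Fin n, (if β i && (g ^ Nat.ofBits x % p).testBit (i : ℕ) then (-1 : ℝ) else 1)) =
      A (fun j => x j && !d j) *
        (A (fun j => x j && d j) * F (G ^ Nat.ofBits (fun j => x j && !d j) * G ^ Nat.ofBits (fun j => x j && d j))) := by
    intro x
    rw [hval x, ← pow_add, add_comm, ← ofBits_split x d, hA, hF]
    simp only
    rw [sign_split α x d]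
    ring
  have hW : ∑ x : QReg n, (∏ i : Fin n, (if α i && x i then (-1 : ℝ) else 1)) *
        (∏ i : Fin n, (if β i && (g ^ Nat.ofBits x % p).testBit (i : ℕ) then (-1 : ℝ) else 1)) =
      ∑ v ∈ PV, A v * I (G ^ Nat.ofBits v) := by
    rw [Finset.sum_congr rfl (fun x _ => hsummand x)]
    rw [← Finset.sum_fiberwise_of_maps_to (s := Finset.univ) (t := PV)
      (g := fun x : QReg n => fun j => x j && !d j) (fun x _ => Finset.mem_image_of_mem _ (Finset.mem_univ x))]
    refine Finset.sum_congr rfl fun v hv => ?_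
    have hv' : ∀ j, d j = true → v j = false := by
      rw [hPV, Finset.mem_image] at hv
      obtain ⟨x, _, rfl⟩ := hv
      intro j hj; simp [hj]
    have step : ∀ x ∈ (Finset.univ.filter fun x : QReg n => (fun j => x j && !d j) = v),
        A (fun j => x j && !d j) *
          (A (fun j => x j && d j) * F (G ^ Nat.ofBits (fun j => x j && !d j) * G ^ Nat.ofBits (fun j => x j && d j))) =
        A v * ((fun u => A u * F (G ^ Nat.ofBits v * G ^ Nat.ofBits u)) (fun j => x j && d j)) := by
      intro x hx
      rw [Finset.mem_filter] at hx
      rw [hx.2]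
    rw [Finset.sum_congr rfl step, ← Finset.mul_sum,
      sum_fibre_block d v hv' (fun u => A u * F (G ^ Nat.ofBits v * G ^ Nat.ofBits u)), ← hPJ']
  rw [hW]
  have htri : |∑ v ∈ PV, A v * I (G ^ Nat.ofBits v)| ≤ ∑ v ∈ PV, |I (G ^ Nat.ofBits v)| := by
    refine (Finset.abs_sum_le_sum_abs _ _).trans (le_of_eq (Finset.sum_congr rfl fun v _ => ?_))
    rw [abs_mul, hA]
    simp only
    rw [abs_sign_prod, one_mul]
  have h4 := sum_abs_pow_four_le PV (fun v => I (G ^ Nat.ofBits v))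
  have hmult := sum_pow_orbit_le hg h2 PV (fun t => (I t) ^ 4)
    (fun t => by positivity)
  have habs0 : 0 ≤ |∑ v ∈ PV, A v * I (G ^ Nat.ofBits v)| := abs_nonneg _
  calc |∑ v ∈ PV, A v * I (G ^ Nat.ofBits v)| ^ 4
      ≤ (∑ v ∈ PV, |I (G ^ Nat.ofBits v)|) ^ 4 := pow_le_pow_left₀ habs0 htri 4
    _ ≤ (PV.card : ℝ) ^ 3 * ∑ v ∈ PV, (I (G ^ Nat.ofBits v)) ^ 4 := h4
    _ ≤ (PV.card : ℝ) ^ 3 * (2 * ∑ t : ZMod p, (I t) ^ 4) :=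
        mul_le_mul_of_nonneg_left hmult (by positivity)

end Holder

/-! ### The registered stubs: `stub_dlogFourthDilationMoment → stub_dlogWalshTwisted` -/

section HolderStub

open Literature.Computability.QuantumComplexity Literature.Computability.Cryptography

/-- The block `{j < m}` has at least `m` positions when `m ≤ n`. -/
theorem le_card_filter_lt (n m : ℕ) (hmn : m ≤ n) :
    m ≤ (Finset.univ.filter fun j : Fin n => decide ((j : ℕ) < m) = true).card := by
  have h := Finset.card_le_card_of_injOn (s := (Finset.univ : Finset (Fin m)))
    (t := Finset.univ.filter fun j : Fin n => decide ((j : ℕ) < m) = true)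
    (fun i : Fin m => (⟨(i : ℕ), lt_of_lt_of_le i.isLt hmn⟩ : Fin n)) ?_ ?_
  · simpa using h
  · intro i _
    rw [Finset.mem_coe, Finset.mem_filter]
    exact ⟨Finset.mem_univ _, by simp⟩
  · intro i _ i' _ h
    simp only [Fin.mk.injEq] at h
    exact Fin.ext h

/-- A product of `±1` signs is `±1`. -/
theorem sign_prod_cases {n : ℕ} (α z : QReg n) :
    (∏ i : Fin n, (if α i && z i then (-1 : ℝ) else 1)) = 1 ∨
    (∏ i : Fin n, (if α i && z i then (-1 : ℝ) else 1)) = -1 :=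
  (abs_eq (zero_le_one)).mp (abs_sign_prod α z)

/-- Real bookkeeping of the Hölder reduction: from `|W|⁴ ≤ T³ · 2M`, `T ≤ 2^{n−m}`,
`M ≤ C(4^m p + 16^m p^{1−η})`, `p ≤ 2ⁿ`, `μ₂ ≤ η₁/2`, `η₁ = min η 1`, `μ₂ n − 1 < m ≤ μ₂ n`:
`|W| ≤ (8C)^{1/4} 2^{(1 − μ₂/4) n}`. -/
theorem holder_numerics (η C : ℝ) (hC : 0 < C) (n m p : ℕ) (W T M : ℝ) (μ₂ : ℝ)
    (hμ₂ : 0 < μ₂) (hμη : 2 * μ₂ ≤ min η 1) (hm1 : μ₂ * n - 1 < m) (hm2 : (m : ℝ) ≤ μ₂ * n)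
    (hp1 : 1 ≤ p) (hp2 : (p : ℝ) ≤ (2 : ℝ) ^ (n : ℝ)) (hW0 : 0 ≤ W) (hT0 : 0 ≤ T)
    (hM0 : 0 ≤ M) (hW : W ^ 4 ≤ T ^ 3 * (2 * M)) (hT : T ≤ (2 : ℝ) ^ ((n : ℝ) - m))
    (hM : M ≤ C * (4 ^ m * (p : ℝ) + 16 ^ m * (p : ℝ) ^ (1 - η))) :
    W ≤ (8 * C) ^ (4 : ℝ)⁻¹ * (2 : ℝ) ^ ((1 - μ₂ / 4) * (n : ℝ)) := by
  have h2pos : (0 : ℝ) < 2 := by norm_num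
  set η₁ : ℝ := min η 1 with hη₁
  have hη₁le : η₁ ≤ η := min_le_left _ _; have hη₁le1 : η₁ ≤ 1 := min_le_right _ _
  have hpR : (1 : ℝ) ≤ p := by exact_mod_cast hp1
  have hpow1 : (p : ℝ) ^ (1 - η) ≤ (2 : ℝ) ^ ((1 - η₁) * (n : ℝ)) := by
    calc (p : ℝ) ^ (1 - η) ≤ (p : ℝ) ^ (1 - η₁) :=
          Real.rpow_le_rpow_of_exponent_le hpR (by linarith)
      _ ≤ ((2 : ℝ) ^ (n : ℝ)) ^ (1 - η₁) :=
          Real.rpow_le_rpow (by positivity) hp2 (by linarith)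
      _ = (2 : ℝ) ^ ((1 - η₁) * (n : ℝ)) := by rw [← Real.rpow_mul h2pos.le]; ring_nf
  have h4m : (4 : ℝ) ^ m = (2 : ℝ) ^ (2 * (m : ℝ)) := by
    rw [Real.rpow_mul h2pos.le, Real.rpow_natCast]; norm_num
  have h16m : (16 : ℝ) ^ m = (2 : ℝ) ^ (4 * (m : ℝ)) := by
    rw [Real.rpow_mul h2pos.le, Real.rpow_natCast]; norm_num
  have hT3 : T ^ 3 ≤ ((2 : ℝ) ^ ((n : ℝ) - m)) ^ 3 := pow_le_pow_left₀ hT0 hT 3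
  have hT3' : ((2 : ℝ) ^ ((n : ℝ) - m)) ^ 3 = (2 : ℝ) ^ (3 * ((n : ℝ) - m)) := by
    rw [← Real.rpow_natCast, ← Real.rpow_mul h2pos.le]; ring_nf
  have hMbound : M ≤ C * ((2 : ℝ) ^ (2 * (m : ℝ) + n) + (2 : ℝ) ^ (4 * (m : ℝ) + (1 - η₁) * n)) := by
    refine hM.trans ?_
    rw [h4m, h16m, Real.rpow_add h2pos, Real.rpow_add h2pos]
    have h1 : (2 : ℝ) ^ (2 * (m : ℝ)) * (p : ℝ) ≤ (2 : ℝ) ^ (2 * (m : ℝ)) * (2 : ℝ) ^ (n : ℝ) :=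
      mul_le_mul_of_nonneg_left hp2 (by positivity)
    have h2 : (2 : ℝ) ^ (4 * (m : ℝ)) * (p : ℝ) ^ (1 - η) ≤
        (2 : ℝ) ^ (4 * (m : ℝ)) * (2 : ℝ) ^ ((1 - η₁) * (n : ℝ)) :=
      mul_le_mul_of_nonneg_left hpow1 (by positivity)
    nlinarith
  have hexp1 : 3 * ((n : ℝ) - m) + (2 * (m : ℝ) + n) ≤ 4 * (n : ℝ) - μ₂ * n + 1 := by linarith
  have hexp2 : 3 * ((n : ℝ) - m) + (4 * (m : ℝ) + (1 - η₁) * n) ≤ 4 * (n : ℝ) - μ₂ * n + 1 := by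
    have hn0 : (0 : ℝ) ≤ n := Nat.cast_nonneg _
    nlinarith
  have key : W ^ 4 ≤ 8 * C * (2 : ℝ) ^ (4 * (n : ℝ) - μ₂ * n) := by
    calc W ^ 4 ≤ T ^ 3 * (2 * M) := hW
      _ ≤ (2 : ℝ) ^ (3 * ((n : ℝ) - m)) * (2 * M) := by
          rw [← hT3']; exact mul_le_mul_of_nonneg_right hT3 (by positivity)
      _ ≤ (2 : ℝ) ^ (3 * ((n : ℝ) - m)) *
          (2 * (C * ((2 : ℝ) ^ (2 * (m : ℝ) + n) + (2 : ℝ) ^ (4 * (m : ℝ) + (1 - η₁) * n)))) :=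
          mul_le_mul_of_nonneg_left (by linarith) (by positivity)
      _ = 2 * C * ((2 : ℝ) ^ (3 * ((n : ℝ) - m) + (2 * (m : ℝ) + n)) +
            (2 : ℝ) ^ (3 * ((n : ℝ) - m) + (4 * (m : ℝ) + (1 - η₁) * n))) := by
          rw [Real.rpow_add h2pos (3 * ((n : ℝ) - m)), Real.rpow_add h2pos (3 * ((n : ℝ) - m))]; ring
      _ ≤ 2 * C * ((2 : ℝ) ^ (4 * (n : ℝ) - μ₂ * n + 1) + (2 : ℝ) ^ (4 * (n : ℝ) - μ₂ * n + 1)) := by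
          refine mul_le_mul_of_nonneg_left (add_le_add
            (Real.rpow_le_rpow_of_exponent_le (by norm_num) hexp1)
            (Real.rpow_le_rpow_of_exponent_le (by norm_num) hexp2)) (by positivity)
      _ = 8 * C * (2 : ℝ) ^ (4 * (n : ℝ) - μ₂ * n) := by
          rw [Real.rpow_add h2pos (4 * (n : ℝ) - μ₂ * n) 1, Real.rpow_one]; ring
  have key2 : W ^ 4 ≤ ((8 * C) ^ (4 : ℝ)⁻¹ * (2 : ℝ) ^ ((1 - μ₂ / 4) * (n : ℝ))) ^ 4 := by
    have h8 : (0 : ℝ) ≤ 8 * C := by positivity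
    rw [mul_pow, ← Real.rpow_natCast ((8 * C) ^ (4 : ℝ)⁻¹) 4, ← Real.rpow_mul h8,
      ← Real.rpow_natCast ((2 : ℝ) ^ ((1 - μ₂ / 4) * (n : ℝ))) 4, ← Real.rpow_mul h2pos.le]
    norm_num
    refine key.trans (le_of_eq ?_)
    ring_nf
  have hK0 : (0 : ℝ) ≤ (8 * C) ^ (4 : ℝ)⁻¹ * (2 : ℝ) ^ ((1 - μ₂ / 4) * (n : ℝ)) := by positivity
  exact (pow_le_pow_iff_left₀ hW0 hK0 (by norm_num : (4 : ℕ) ≠ 0)).mp key2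

/-- **Stub `stub_dlogWalshHolder`**: the fourth dilation moment bound (FDM,
`stub_dlogFourthDilationMoment`) for the digital functions `F_β(y) = (−1)^{β·bits y}` along the
geometric progressions `{λ gˣ : x < 2^m}` implies the twisted-Walsh bound of the crux
(`stub_dlogWalshTwisted`, sector B with `α ≠ 0`): Burgess amplification — split the exponent at
digit `m = ⌊μ₂ n⌋`, Hölder (two Cauchy–Schwarz steps) over the high patterns, multiplicity ≤ 2 of
the outer multipliers `g^{ofBits v}` (`stub_dlogOrbitFibre`), positivity; both masks' dependence on
`x` disappears (`walsh_pow_four_le_moment`), then `|W|⁴ ≤ 2^{3(n−m)}·2C(4^m p + 16^m p^{1−η})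
≤ 8C·2^{(4−μ₂)n}` with `μ₂ = min(μ, min(η,1)/2)`, `δ = μ₂/8`. -/
theorem stub_dlogWalshHolder :
    (∃ η : ℝ, 0 < η ∧ ∃ μ : ℝ, 0 < μ ∧ ∃ C : ℝ, 0 < C ∧ ∃ n₀ : ℕ, ∀ n ≥ n₀,
      ∀ (p : ℕ) [Fact (Nat.Prime p)] (g : ℕ), p < 2 ^ n → 2 ^ n ≤ p + 2 ^ (53 * n / 100) →
      orderOf (g : ZMod p) = p - 1 →
      (∀ c : Fin (n + 1) → ℤ, (∀ i, c i = 0 ∨ c i = 1 ∨ c i = -1) →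
        ∑ i, c i * 2 ^ (i : ℕ) = (p : ℤ) - 1 → n ≤ 8 * (Finset.univ.filter fun i => c i ≠ 0).card) →
      ∀ β : QReg n, β ≠ (fun _ => false) → ∀ m : ℕ, (m : ℝ) ≤ μ * (n : ℝ) →
      ∀ ε : QReg n → ℝ, (∀ u, ε u = 1 ∨ ε u = -1) →
      ∑ lam : ZMod p,
        (∑ u ∈ (Finset.univ.filter fun u : QReg n => ∀ j : Fin n, m ≤ (j : ℕ) → u j = false),
          ε u * ∏ i : Fin n, (if β i && (lam * (g : ZMod p) ^ Nat.ofBits u).val.testBit (i : ℕ)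
            then (-1 : ℝ) else 1)) ^ 4 ≤
        C * (4 ^ m * (p : ℝ) + 16 ^ m * (p : ℝ) ^ (1 - η))) →
    (∃ δ : ℝ, 0 < δ ∧ ∃ n₀ : ℕ, ∀ n ≥ n₀, ∀ p g : ℕ, p.Prime → p < 2 ^ n →
      2 ^ n ≤ p + 2 ^ (53 * n / 100) → orderOf (g : ZMod p) = p - 1 →
      (∀ c : Fin (n + 1) → ℤ, (∀ i, c i = 0 ∨ c i = 1 ∨ c i = -1) →
        ∑ i, c i * 2 ^ (i : ℕ) = (p : ℤ) - 1 → n ≤ 8 * (Finset.univ.filter fun i => c i ≠ 0).card) →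
      ∀ β : QReg n, β ≠ (fun _ => false) → ∀ α : QReg n, α ≠ (fun _ => false) →
      |∑ x : QReg n, (∏ i : Fin n, (if α i && x i then (-1 : ℝ) else 1)) *
          (∏ i : Fin n, (if β i && (g ^ Nat.ofBits x % p).testBit (i : ℕ) then (-1 : ℝ) else 1))|
        ≤ (2 : ℝ) ^ ((1 - δ) * (n : ℝ))) := by
  rintro ⟨η, hη, μ, hμ, C, hC, n₀, hF⟩
  set μ₂ : ℝ := min μ (min η 1 / 2) with hμ₂
  have hμ₂pos : 0 < μ₂ := lt_min hμ (by positivity)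
  have hμ₂μ : μ₂ ≤ μ := min_le_left _ _
  have hμ₂η : 2 * μ₂ ≤ min η 1 := by
    have := min_le_right μ (min η 1 / 2); rw [← hμ₂] at this; linarith
  have hμ₂half : μ₂ ≤ 1 / 2 := by
    have h1 : min η 1 ≤ 1 := min_le_right _ _
    linarith
  set δ : ℝ := μ₂ / 8 with hδ
  have hδpos : 0 < δ := by positivity
  set K : ℝ := (8 * C) ^ (4 : ℝ)⁻¹ with hK
  have hKpos : 0 < K := by positivity
  obtain ⟨n₁, hn₁⟩ := exists_nat_ge (Real.logb 2 K / (μ₂ / 8))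
  refine ⟨δ, hδpos, max (max n₀ 4) n₁, ?_⟩
  intro n hn p g hp hpn hwin hg hguard β hβ α _hα
  classical
  haveI hpf : Fact p.Prime := ⟨hp⟩
  have hn₀ : n₀ ≤ n := le_trans ((le_max_left _ _).trans (le_max_left _ _)) hn
  have hn4 : 4 ≤ n := le_trans ((le_max_right _ _).trans (le_max_left _ _)) hn
  have hnn₁ : n₁ ≤ n := le_trans (le_max_right _ _) hn
  have h53 : 53 * n / 100 ≤ n - 2 := by omega
  have hq : 2 ^ (53 * n / 100) ≤ 2 ^ (n - 2) := Nat.pow_le_pow_right (by norm_num) h53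
  have h2n : 2 ^ n = 4 * 2 ^ (n - 2) := by
    conv_lhs => rw [show n = (n - 2) + 2 from by omega, Nat.pow_add]
    ring
  have hq4 : 4 ≤ 2 ^ (n - 2) := by
    calc 4 = 2 ^ 2 := by norm_num
      _ ≤ 2 ^ (n - 2) := Nat.pow_le_pow_right (by norm_num) (by omega)
  have hp3 : 3 * 2 ^ (n - 2) ≤ p := by omega
  have h2p1 : 2 ^ n ≤ 2 * (p - 1) := by omega
  set m : ℕ := ⌊μ₂ * n⌋₊ with hm
  have hμn0 : 0 ≤ μ₂ * n := by positivity
  have hm2 : (m : ℝ) ≤ μ₂ * n := Nat.floor_le hμn0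
  have hm1 : μ₂ * n - 1 < m := by
    have := Nat.lt_floor_add_one (μ₂ * n); rw [← hm] at this; linarith
  have hmμ : (m : ℝ) ≤ μ * n := hm2.trans (mul_le_mul_of_nonneg_right hμ₂μ (Nat.cast_nonneg _))
  have hmn : m ≤ n := by
    have : (m : ℝ) ≤ n := by
      have hn0 : (0 : ℝ) ≤ n := Nat.cast_nonneg _
      nlinarith
    exact_mod_cast this
  have hH := walsh_pow_four_le_moment (p := p) (g := g) hg h2p1 α β m
  have hM := hF n hn₀ p g hpn hwin hg hguard β hβ m hmμ
    (fun u => ∏ i : Fin n, (if α i && u i then (-1 : ℝ) else 1)) (fun u => sign_prod_cases α u)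
  have hT : ((Finset.univ.image fun x : QReg n => fun j => x j && !decide ((j : ℕ) < m)).card : ℝ)
      ≤ (2 : ℝ) ^ ((n : ℝ) - m) := by
    have h1 := card_image_bits_out_le (n := n) (fun j => decide ((j : ℕ) < m))
    have h2 := le_card_filter_lt n m hmn
    have h3 : (Finset.univ.image fun x : QReg n => fun j => x j && !decide ((j : ℕ) < m)).card
        ≤ 2 ^ (n - m) :=
      h1.trans (Nat.pow_le_pow_right (by norm_num) (by omega))
    have h4 : ((2 ^ (n - m) : ℕ) : ℝ) = (2 : ℝ) ^ ((n : ℝ) - m) := by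
      rw [← Nat.cast_sub hmn, Real.rpow_natCast]; push_cast; ring
    rw [← h4]; exact_mod_cast h3
  have hp2 : (p : ℝ) ≤ (2 : ℝ) ^ (n : ℝ) := by
    rw [Real.rpow_natCast]; exact_mod_cast hpn.le
  have hres := holder_numerics η C hC n m p _ _ _ μ₂ hμ₂pos hμ₂η hm1 hm2 hp.one_le hp2
    (abs_nonneg _) (Nat.cast_nonneg _) (Finset.sum_nonneg fun _ _ => by positivity) hH hT hM
  refine hres.trans ?_
  have h2pos : (0 : ℝ) < 2 := by norm_num
  have hμ8 : (0 : ℝ) < μ₂ / 8 := by positivity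
  have hn₁' : Real.logb 2 K / (μ₂ / 8) ≤ (n : ℝ) := hn₁.trans (by exact_mod_cast hnn₁)
  have hlog : Real.logb 2 K ≤ (μ₂ / 8) * (n : ℝ) := by
    rw [div_le_iff₀ hμ8] at hn₁'; linarith
  have hK2 : K ≤ (2 : ℝ) ^ ((μ₂ / 8) * (n : ℝ)) :=
    (Real.logb_le_iff_le_rpow (by norm_num) hKpos).mp hlog
  have hsplit : (2 : ℝ) ^ ((1 - δ) * (n : ℝ)) =
      (2 : ℝ) ^ ((μ₂ / 8) * (n : ℝ)) * (2 : ℝ) ^ ((1 - μ₂ / 4) * (n : ℝ)) := by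
    rw [← Real.rpow_add h2pos, hδ]; ring_nf
  rw [hsplit]
  exact mul_le_mul_of_nonneg_right hK2 (by positivity)

end HolderStub

end Summit.QuantumAdvantage.QuantumAdvantage.Theorems.SymplecticPurity
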